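/-
Copyright (c) 2026 the pub-hodgecm-mathlib formalisation cell (harness21).  Prover seat hodgecm-mathlib-LH4-p04 (g9), req620 Track A «(D-RAM) FOUR-FRAME» squad
((β₂) road (R-36), β₂-BOARD v2 row (L-Σ), brick (L-Σ-3B) ED. 3-0: the pure `Finset` arithmetic of the diagonal row — filter at `2b = m`, the `IsOrd` guard, the window re-index), 2026-09-04.
-/
import Mathlib.Algebra.BigOperators.Ring.Finset
import Mathlib.Algebra.Order.BigOperators.Group.Finset
import Mathlib.Algebra.BigOperators.Intervals
import HarnessLib

/-!
# Crux `H413`, line LH4 «(D-RAM) FOUR-FRAME» — (β₂) road, brick (L-Σ-3B) ED. 3-0: «ROW-SUM WINDOW ARITHMETIC» (pure `Finset` algebra over `ℤ`, no field, no lattice)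

Cell `hodgecm-mathlib` (D-0151), FLOOR 0, crux item H413 = `stmt-HodgeConjecture-24833`, route of record `HCCMUnconditional`; squad F0∕P3c∕LH4; lane
`--supports stmt-HodgeConjecture-24833 --as helper` (count-neutral).  THEOREMS ONLY (no `def`, no instance, no notation, no `sorry`, default heartbeats).
WHY.  ★ p862801 `beta2ConesB_of_rows` left the lane-B cone ledger as ‹ROW.letter.v1›: per literal a sum `Σ_{b ∈ (Icc 1 R).filter (2b = m)} Σ_{j < J+1} [IsOrd_j lam]·X(j,b)`.
ED. 3 (`row_of_core`, this seat) reduces it to the WINDOWED identity over the cells `j = b + 2i`; THIS FILE is its arithmetic shell, typed once: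
* §1 `sum_filter_two_mul_eq` — the filter `2b = m` keeps at most the one index `m ∕ 2`: `Σ_{b ∈ S, 2b = m} G b = if m % 2 = 0 ∧ m∕2 ∈ S then G (m∕2) else 0`;
* §2 `sum_range_ite_le_eq` — a guard `j ≤ jl` inside `Σ_{j < J+1}` with `jl ≤ J` truncates the range: `= Σ_{j < jl+1}`;
* §3 `sum_range_eq_sum_window` — if `F` vanishes on `[0, jl]` off the arithmetic progression `b, b+2, …, b+2(K−1) ≤ jl`, then `Σ_{j < jl+1} F j = Σ_{i < K} F (b + 2i)`.
HONEST LABEL.  Arithmetic only; nothing printed is asserted; β₂ ∕ ‹ROW› stay HYPOTHESES; `HC_CM` is proved only modulo the 7 printed citations (2 remaining named inputs: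
hLiu418 = `stmt-HodgeConjecture-24832`, h413 = `stmt-HodgeConjecture-24833`) until rung 0 closes.
References: [Kottwitz1986BaseChangeUnits] R. E. Kottwitz, Compositio Math. 60 (1986), §1 pp. 240–241 (cell-by-cell lattice bookkeeping) ·
[Rogawski1990] Ann. of Math. Stud. 123, §4.9 Prop. 4.9.1 (b) p. 55.
-/

set_option autoImplicit false

namespace Summit.HodgeConjecture.HodgeConjecture.Cruxes.H413.F0P3cDyRamRowSumWindowArithmetic

open Finset

/-! ## §1 The filter `2b = m` -/

/-- **THE ROW FILTER KEEPS AT MOST ONE TUBE DEPTH.**  `Σ_{b ∈ S, 2b = m} G b = if m % 2 = 0 ∧ m ∕ 2 ∈ S then G (m ∕ 2) else 0`.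
[cite: Kottwitz1986BaseChangeUnits, §1 pp. 240–241] -/
theorem sum_filter_two_mul_eq (S : Finset ℕ) (G : ℕ → ℤ) (m : ℕ) :
    ∑ b ∈ S.filter (fun b => 2 * b = m), G b = if m % 2 = 0 ∧ m / 2 ∈ S then G (m / 2) else 0 := by
  by_cases hpar : m % 2 = 0
  · have hS : S.filter (fun b => 2 * b = m) = S.filter (fun b => b = m / 2) :=
      filter_congr fun b _ => by omega
    rw [hS, filter_eq' S (m / 2)]
    by_cases hmem : m / 2 ∈ S
    · rw [if_pos hmem, if_pos ⟨hpar, hmem⟩, sum_singleton]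
    · rw [if_neg hmem, if_neg (fun h => hmem h.2), sum_empty]
  · rw [if_neg (fun h => hpar h.1)]
    exact sum_eq_zero fun b hb => absurd (mem_filter.1 hb).2 (by omega)

/-! ## §2 The `IsOrd` guard as a truncation -/

/-- **A GUARD `j ≤ jl` TRUNCATES THE LEVEL RANGE** (`jl ≤ J`): `Σ_{j < J+1} (if j ≤ jl then F j else 0) = Σ_{j < jl+1} F j`. [cite: Kottwitz1986BaseChangeUnits, §1 pp. 240–241] -/
theorem sum_range_ite_le_eq (F : ℕ → ℤ) {J jl : ℕ} (hjl : jl ≤ J) :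
    ∑ j ∈ range (J + 1), (if j ≤ jl then F j else 0) = ∑ j ∈ range (jl + 1), F j := by
  rw [← sum_filter]
  refine sum_congr ?_ fun _ _ => rfl
  ext j
  simp only [mem_filter, mem_range]
  omega

/-! ## §3 The window re-index `j = b + 2i` -/

/-- **OFF THE WINDOW THE SUMMAND VANISHES ⟹ THE LEVEL SUM IS THE WINDOW SUM.**  If `b + 2i ≤ jl` for `i < K` and `F j = 0` for every `j ≤ jl` not of the form `b + 2i`
(`i < K`), then `Σ_{j < jl+1} F j = Σ_{i < K} F (b + 2i)`. [cite: Kottwitz1986BaseChangeUnits, §1 pp. 240–241] [cite: Rogawski1990, §4.9 Prop. 4.9.1 (b) p. 55] -/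
theorem sum_range_eq_sum_window (F : ℕ → ℤ) (b K jl : ℕ) (hK : ∀ i, i < K → b + 2 * i ≤ jl)
    (hF : ∀ j, j ≤ jl → (∀ i, i < K → j ≠ b + 2 * i) → F j = 0) :
    ∑ j ∈ range (jl + 1), F j = ∑ i ∈ range K, F (b + 2 * i) := by
  have hinj : ∀ x ∈ range K, ∀ y ∈ range K, b + 2 * x = b + 2 * y → x = y := fun x _ y _ h => by omega
  rw [← sum_image hinj]
  symm
  refine sum_subset (fun j hj => ?_) (fun j hj hnot => ?_)
  · obtain ⟨i, hi, rfl⟩ := mem_image.1 hj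
    exact mem_range.2 (Nat.lt_succ_of_le (hK i (mem_range.1 hi)))
  · refine hF j (Nat.le_of_lt_succ (mem_range.1 hj)) fun i hi hji => hnot ?_
    exact mem_image.2 ⟨i, mem_range.2 hi, hji.symm⟩

end Summit.HodgeConjecture.HodgeConjecture.Cruxes.H413.F0P3cDyRamRowSumWindowArithmetic
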